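import Literature.Probability.LatticeModels.TruncatedWeightLipschitz
import Summits.QuantumFields.BalabanUV.T4Continuum.Spine.NE7.Targets

/-!
# YM-DAG node N19 (= NE7 proper) — `Spine.NE7.Core` READ OFF A KOTECKÝ–PREISS CLASS-GAS REPRESENTATION of the two runs' good-class
# cores: the sandwich from (KP for both runs) + (recent two-run activity budget `ρ`) + (old polymers by size `W`) + (the class PREFACTOR
# contrast `η` modulo ONE constant `c₀`) — the class-uniform constant of `Core` costs exactly the class-uniformity of the prefactor contrast

Cell `pub-ymgap`, HUMAN RULING D-0062 (Track A), width seat `pub-ymgap-dag-n19-w2` (node n19 = NE7), generation g7 (explicit-unit brief «take a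
sub-lemma no sibling holds», R455 (A) rule (ii) self-located piece; CLAIM-1 on the cell bus 2026-08-28T10:15Z, FILE A of two).  Route
`Summits/QuantumFields/YangMills/Theses/BalabanUVNodes.lean`, key item K3⁸ `SpineGivenEndpointR13SepCoPHV` (stmt-QuantumFields-27366; aside
predecessor K3⁷ 20544); filed `--kind proof --supports … --as helper`.  COUNT-NEUTRAL.  THEOREMS ONLY (0 `def`, 0 `instance`, 0 `sorry`).  Imports
the tree's KERNEL-PROVED Kotecký–Preiss library (`Literature.Probability.LatticeModels.{ClusterExpansion, PolymerLogZLipschitz, TruncatedWeightLipschitz}`)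
and `Spine/NE7/Targets`; every cluster-expansion fact is used BY NAME, nothing is restated.  Companion FILE B `…N19TargetOfSourceLocalGasReading`
(source locality, canonical constants ⇒ `Target`).

THE QUESTION.  The N19′ face of stub 2 of the K3 skeleton (v5 941dddb108cbaacf on 20544; «v6» for 27366, plan kit `D85-REV28/k3v6/`) is
`∃ δ, NE7.Core l₀ vol T Bad (A − shA) (B − shB) δ ∧ Summable δ` at the spine reading: for every `K` ONE constant `c_K`, independent of the source
`t` AND of the class `τ`, with `e^{c_K − vol·δ_K}·P ≤ Q ≤ e^{c_K + vol·δ_K}·P` on every good class (`Spine/NE7/Targets` :71).  The printed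
ONE-RUN FORMAT of a final-scale small-field density is a Kotecký–Preiss polymer gas ([Balaban1989LargeFieldII] (1.98) p. 390 — tree
`B16Exp198.logZ_eq_sum_locR`; [Balaban1988RG2Cluster] (2.11)–(2.13) pp. 14–15 — tree `B13Sect2Statements.polymerExpansion_211`), and the tree's
`B16Exp198TwoRun` header says in prose that a two-run comparison of such gases «holds for ANY two activity families obeying the Kotecký–Preiss
hypothesis (1) on a common geometry», «the activity-level two-run RATE … NOT PRINTED … a BINDER».  THIS FILE is the N19-currency face of that
sentence — what `Core`, WITH ITS CLASS-UNIFORM CONSTANT, costs when the good-class cores are READ as prefactor × Kotecký–Preiss partition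
function — and, through the prefactor budget `η`, displays WHERE the crux card `Cruxes/SpineGivenEndpointR13SepCoPH/Ideas/window-key-core.md`
locates the obstruction at the pinned key `crOfRecord₁₃V` (the two-run contrast of the OLD large-field block factors is class-dependent,
`η_K ≈ n_K(τ)·D₀` with `D₀ ≠ 0` — not `≤ vol·δ_K` with `Σ δ_K < ∞`; at a key whose prefactors see only the 𝐑-window it is not).

WHAT IS KERNEL-CHECKED ([folklore] algebra over the tree's theorems BY NAME).
* §1 ONE `(K, t, τ)`.  Class cores `A = F_A · Z(Λ; w_A).re`, `B = F_B · Z(Λ; w_B).re`, REAL activities (no sign condition) both Kotecký–Preiss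
  with size function `a` on the class volume `Λ` (so both partition functions are positive reals —
  `PolymerLogZLipschitz.abs_log_re_polymerPartitionFunction_sub_le`), positive prefactors (large-field block factors, counterterms `e^{−E}`,
  normalisations), a HYBRID SPLIT `O ⊆ Λ`: `|log B − log A − c₀| ≤ ρ + W + η` (`abs_log_sub_log_sub_le_of_classGas`) and
  `e^{c₀−(ρ+W+η)}·A ≤ B ≤ e^{c₀+(ρ+W+η)}·A` (`sandwich_of_classGas`; pure-gas case `…_pure`: constant ZERO), where `ρ ≥ Σ_{Λ∖O}|w_A − w_B|e^{a}`
  (RECENT polymers compared — the two-run rate, NOT PRINTED), `W ≥ Σ_O(|w_A| + |w_B|)e^{a}` (OLD polymers by size; the tree's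
  `sum_kpTerm_add_kpTerm_le_of_pinned` prices them by anchors), `η ≥ |log F_B − log F_A − c₀|` (PREFACTOR CONTRAST about the one `c₀`).
  The gas half is the tree's `abs_log_re_sub_le_of_budgets` BY NAME; new is the prefactor slot and the `Core` currency.
* §2 ALONG `K`.  `core_of_classGasReading`: core families `P, Q : ℕ → ℝ → ι → ℝ` READ on the good classes `τ ∈ T K ∖ Bad K t`, `|t| ≤ l₀`, as
  such class gases (everything `(K,t,τ)`-dependent; size function `a K`), per-`K` budgets about ONE constant `c₀ K` (uniform in `t` AND `τ` —
  the load-bearing clause) with `ρ_K + W_K + η_K ≤ vol·δ_K` ⇒ `NE7.Core l₀ vol T Bad P Q δ`, `c_K := c₀ K`; `coreEdge_of_classGasReading`: +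
  `Summable δ` ⇒ the N19′ shape `∃ δ, Core … δ ∧ Summable δ`.  READING = hypotheses `hP`∕`hQ`; nothing asserted about any datum.
* §3 SANITY (A6): equal activities, `O = ∅`, unit prefactors — the trivial sandwich (content-free; joint satisfiability only; a non-degenerate
  KP inhabitant is the tree's `LocalPerturbationClusterExpansion`, not re-derived).
LOCATED REMARKS.  (i) the gas part is class-blind once `ρ_K + W_K ≤ vol·δ_K` uniformly in `τ`; with the torus factor `vol` in the radius a
UNIFORM summable two-run activity rate already affords `ρ_K` (`≤ ε_K·Σ_Λ ω e^{a}`, extensive) — the class-uniform constant is paid ONLY at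
`η`.  (ii) Instantiating the reading for Bałaban's runs needs the (1.98)∕(2.13) representation of BOTH runs' final densities on a COMMON
polymer geometry (node U5a), the Kotecký–Preiss bound for both (printed for ONE run: [Balaban1989LargeFieldII] (1.97)∕(1.99),
[Balaban1988RG2Cluster] Lemma 3 (2.38)), the two-run activity rate (NE-R1 two-run half ∕ NE5-ACT ∕ NE7b-rem — NOT PRINTED) and the prefactor
contrast (NOT PRINTED) — BINDERS here, produced by nobody.

HONEST FRAMING.  [folklore]-grade bookkeeping over the tree's kernel-proved abstract cluster expansion ([KoteckyPreiss1986] Theorem p. 492, as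
formalised in `Literature.Probability.LatticeModels` — a PUBLISHED result outside the audited series) on HYPOTHESIS SHAPES; ZERO Bałaban content
instantiated (no `Provisos₁₃CoPH` tuple, no datum, no `crOfRecord₁₃V`); NE7 ∕ NE7b ∕ NE7c NOT PRINTED as two-run statements for d = 4 and NOT
proved; N19 ∕ N20 ∕ N21 NOT discharged; K3⁸ 27366 OPEN («v6» pending registration), K3⁷ 20544 aside, neither claimed; counts UNMOVED (typed
28∕28 · discharged 5∕27, A 5∕28); no count claim.  One finite four-torus programme at fixed ε, Bałaban AS PRINTED; R4 closes the conditional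
finite-𝕋⁴ rung `BalabanLadder.UV` only — NOT infinite volume, NOT OS on ℝ⁴, NOT the Yang–Mills mass gap, NOT the Clay problem.  0 `def`;
0 `sorry`; standard axioms; no cite tags (Summits side).
-/

noncomputable section

open Finset
open scoped BigOperators

namespace Summit.QuantumFields.YangMills.BalabanUVNodes.N19CoreOfClassGasReading

open Literature.Probability.LatticeModels
open Summit.QuantumFields.BalabanUV.T4Continuum.Spine

variable {P : Type*} [DecidableEq P] {inc : P → P → Prop} [DecidableRel inc]

/-! ## §1 ONE `(K, t, τ)`: the class-gas sandwich with a prefactor budget -/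

section OneClass

variable [Std.Refl inc] [Std.Symm inc]

/-- **THE CLASS-GAS LOG BOUND.**  Two REAL activity families `wA`, `wB` (`im = 0`, no sign condition), both Kotecký–Preiss with size
function `a` on the class volume `Λ`; a hybrid split `O ⊆ Λ` with the RECENT two-run budget `Σ_{Λ∖O} ‖wA − wB‖ e^{a} ≤ ρ` and the OLD
size budget `Σ_O (‖wA‖e^{a} + ‖wB‖e^{a}) ≤ W`; positive prefactors `FA`, `FB` whose contrast is `c₀` up to `η`.  Then the class cores
`A = FA · Z(Λ; wA).re`, `B = FB · Z(Λ; wB).re` satisfy `|log B − log A − c₀| ≤ ρ + W + η`.  The gas half is the tree's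
`PolymerLogZLipschitz.abs_log_re_sub_le_of_budgets` BY NAME. [folklore] -/
theorem abs_log_sub_log_sub_le_of_classGas {wA wB : P → ℂ} {a : P → ℝ} {Λ O : Finset P} {ρ W η c₀ FA FB : ℝ}
    (hA : IsKPVolume inc wA a Λ) (hB : IsKPVolume inc wB a Λ) (hAr : ∀ γ, (wA γ).im = 0) (hBr : ∀ γ, (wB γ).im = 0)
    (hO : O ⊆ Λ) (hrec : ∑ δ ∈ Λ \ O, ‖wA δ - wB δ‖ * Real.exp (a δ) ≤ ρ)
    (hold : ∑ δ ∈ O, (kpTerm wA a δ + kpTerm wB a δ) ≤ W)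
    (hFA : 0 < FA) (hFB : 0 < FB) (hF : |Real.log FB - Real.log FA - c₀| ≤ η) :
    |Real.log (FB * (polymerPartitionFunction inc wB Λ).re) - Real.log (FA * (polymerPartitionFunction inc wA Λ).re) - c₀| ≤
      ρ + W + η := by
  obtain ⟨hZA, hZB, -⟩ := abs_log_re_polymerPartitionFunction_sub_le hA hB hAr hBr
  have hgas := abs_log_re_sub_le_of_budgets hA hB hAr hBr hO hrec hold
  rw [Real.log_mul hFB.ne' hZB.ne', Real.log_mul hFA.ne' hZA.ne']
  have hsplit : Real.log FB + Real.log (polymerPartitionFunction inc wB Λ).re -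
      (Real.log FA + Real.log (polymerPartitionFunction inc wA Λ).re) - c₀ =
      (Real.log FB - Real.log FA - c₀) -
        (Real.log (polymerPartitionFunction inc wA Λ).re - Real.log (polymerPartitionFunction inc wB Λ).re) := by ring
  rw [hsplit]
  calc |Real.log FB - Real.log FA - c₀ -
        (Real.log (polymerPartitionFunction inc wA Λ).re - Real.log (polymerPartitionFunction inc wB Λ).re)|
      ≤ |Real.log FB - Real.log FA - c₀| +
        |Real.log (polymerPartitionFunction inc wA Λ).re - Real.log (polymerPartitionFunction inc wB Λ).re| := abs_sub _ _
    _ ≤ η + (ρ + W) := add_le_add hF hgas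
    _ = ρ + W + η := by ring

/-- **THE CLASS-GAS SANDWICH** (the `Core` currency of one good class): under the hypotheses of `abs_log_sub_log_sub_le_of_classGas`,
`e^{c₀ − (ρ+W+η)} · A ≤ B ≤ e^{c₀ + (ρ+W+η)} · A` for `A = FA · Z(Λ; wA).re`, `B = FB · Z(Λ; wB).re` — `Spine.NE7.Targets`'
`sandwich_of_abs_log_sub_le` BY NAME on positive cores. [folklore] -/
theorem sandwich_of_classGas {wA wB : P → ℂ} {a : P → ℝ} {Λ O : Finset P} {ρ W η c₀ FA FB : ℝ}
    (hA : IsKPVolume inc wA a Λ) (hB : IsKPVolume inc wB a Λ) (hAr : ∀ γ, (wA γ).im = 0) (hBr : ∀ γ, (wB γ).im = 0)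
    (hO : O ⊆ Λ) (hrec : ∑ δ ∈ Λ \ O, ‖wA δ - wB δ‖ * Real.exp (a δ) ≤ ρ)
    (hold : ∑ δ ∈ O, (kpTerm wA a δ + kpTerm wB a δ) ≤ W)
    (hFA : 0 < FA) (hFB : 0 < FB) (hF : |Real.log FB - Real.log FA - c₀| ≤ η) :
    Real.exp (c₀ - (ρ + W + η)) * (FA * (polymerPartitionFunction inc wA Λ).re) ≤ FB * (polymerPartitionFunction inc wB Λ).re ∧
      FB * (polymerPartitionFunction inc wB Λ).re ≤ Real.exp (c₀ + (ρ + W + η)) * (FA * (polymerPartitionFunction inc wA Λ).re) := by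
  obtain ⟨hZA, hZB, -⟩ := abs_log_re_polymerPartitionFunction_sub_le hA hB hAr hBr
  exact NE7.sandwich_of_abs_log_sub_le (mul_pos hFA hZA) (mul_pos hFB hZB)
    (abs_log_sub_log_sub_le_of_classGas hA hB hAr hBr hO hrec hold hFA hFB hF)

/-- The PURE-GAS case of §1 (`F ≡ 1`, `c₀ = 0`, `η = 0`): two KP class gases with real activities and budgets `ρ` (recent, compared)
and `W` (old, by size) have `e^{−(ρ+W)} Z_A ≤ Z_B ≤ e^{ρ+W} Z_A` — matching with constant ZERO: «modulo constants» is only needed for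
what the prefactors carry. [folklore] -/
theorem sandwich_of_classGas_pure {wA wB : P → ℂ} {a : P → ℝ} {Λ O : Finset P} {ρ W : ℝ}
    (hA : IsKPVolume inc wA a Λ) (hB : IsKPVolume inc wB a Λ) (hAr : ∀ γ, (wA γ).im = 0) (hBr : ∀ γ, (wB γ).im = 0)
    (hO : O ⊆ Λ) (hrec : ∑ δ ∈ Λ \ O, ‖wA δ - wB δ‖ * Real.exp (a δ) ≤ ρ)
    (hold : ∑ δ ∈ O, (kpTerm wA a δ + kpTerm wB a δ) ≤ W) :
    Real.exp (-(ρ + W)) * (polymerPartitionFunction inc wA Λ).re ≤ (polymerPartitionFunction inc wB Λ).re ∧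
      (polymerPartitionFunction inc wB Λ).re ≤ Real.exp (ρ + W) * (polymerPartitionFunction inc wA Λ).re := by
  have h := sandwich_of_classGas (ρ := ρ) (W := W) (η := 0) (c₀ := 0) (FA := 1) (FB := 1) hA hB hAr hBr hO hrec hold
    one_pos one_pos (by simp)
  simp only [one_mul, add_zero, zero_sub, zero_add] at h
  exact h

end OneClass

/-! ## §2 ALONG `K`: a class-gas reading of the good-class cores ⇒ `NE7.Core` (class-uniform constant `c₀ K`) -/

section AlongK

variable [Std.Refl inc] [Std.Symm inc] {ι : Type*} [DecidableEq ι]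

/-- **`NE7.Core` FROM A CLASS-GAS READING.**  Core families `P`, `Q` (the two runs' shell-free good-class cores) READ on every good
class `τ ∈ T K ∖ Bad K t`, `|t| ≤ l₀`, as `P = FA · Z(Λ; wA).re`, `Q = FB · Z(Λ; wB).re` (volumes, splits, activities, prefactors all
`(K, t, τ)`-dependent; size function `a K`), with REAL Kotecký–Preiss activities, positive prefactors, and per-`K` budgets: recent two-run
`ρ K`, old-by-size `W K`, prefactor contrast `η K` about ONE constant `c₀ K` (uniform in `t` AND `τ` — the load-bearing clause), and
`ρ K + W K + η K ≤ vol · δ K`.  Then `NE7.Core l₀ vol T Bad P Q δ` with `c_K := c₀ K`. [folklore] -/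
theorem core_of_classGasReading {l₀ vol : ℝ} {T : ℕ → Finset ι} {Bad : ℕ → ℝ → Finset ι} {P' Q' : ℕ → ℝ → ι → ℝ} {δ : ℕ → ℝ}
    (Λ O : ℕ → ℝ → ι → Finset P) (wA wB : ℕ → ℝ → ι → P → ℂ) (a : ℕ → P → ℝ) (FA FB : ℕ → ℝ → ι → ℝ) (c₀ ρ W η : ℕ → ℝ)
    (hKPA : ∀ K t, |t| ≤ l₀ → ∀ τ ∈ T K \ Bad K t, IsKPVolume inc (wA K t τ) (a K) (Λ K t τ))
    (hKPB : ∀ K t, |t| ≤ l₀ → ∀ τ ∈ T K \ Bad K t, IsKPVolume inc (wB K t τ) (a K) (Λ K t τ))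
    (hAr : ∀ K t τ γ, (wA K t τ γ).im = 0) (hBr : ∀ K t τ γ, (wB K t τ γ).im = 0) (hO : ∀ K t τ, O K t τ ⊆ Λ K t τ)
    (hrec : ∀ K t, |t| ≤ l₀ → ∀ τ ∈ T K \ Bad K t,
      ∑ δ' ∈ Λ K t τ \ O K t τ, ‖wA K t τ δ' - wB K t τ δ'‖ * Real.exp (a K δ') ≤ ρ K)
    (hold : ∀ K t, |t| ≤ l₀ → ∀ τ ∈ T K \ Bad K t, ∑ δ' ∈ O K t τ, (kpTerm (wA K t τ) (a K) δ' + kpTerm (wB K t τ) (a K) δ') ≤ W K)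
    (hFA : ∀ K t τ, 0 < FA K t τ) (hFB : ∀ K t τ, 0 < FB K t τ)
    (hF : ∀ K t, |t| ≤ l₀ → ∀ τ ∈ T K \ Bad K t, |Real.log (FB K t τ) - Real.log (FA K t τ) - c₀ K| ≤ η K)
    (hbud : ∀ K, ρ K + W K + η K ≤ vol * δ K)
    (hP : ∀ K t, |t| ≤ l₀ → ∀ τ ∈ T K \ Bad K t, P' K t τ = FA K t τ * (polymerPartitionFunction inc (wA K t τ) (Λ K t τ)).re)
    (hQ : ∀ K t, |t| ≤ l₀ → ∀ τ ∈ T K \ Bad K t, Q' K t τ = FB K t τ * (polymerPartitionFunction inc (wB K t τ) (Λ K t τ)).re) :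
    NE7.Core l₀ vol T Bad P' Q' δ := by
  intro K
  refine ⟨c₀ K, fun t ht τ hτ => ?_⟩
  have hlog := abs_log_sub_log_sub_le_of_classGas (hKPA K t ht τ hτ) (hKPB K t ht τ hτ) (hAr K t τ) (hBr K t τ) (hO K t τ)
    (hrec K t ht τ hτ) (hold K t ht τ hτ) (hFA K t τ) (hFB K t τ) (hF K t ht τ hτ)
  obtain ⟨hZA, hZB, -⟩ := abs_log_re_polymerPartitionFunction_sub_le (hKPA K t ht τ hτ) (hKPB K t ht τ hτ) (hAr K t τ) (hBr K t τ)
  rw [hP K t ht τ hτ, hQ K t ht τ hτ]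
  exact NE7.sandwich_of_abs_log_sub_le (mul_pos (hFA K t τ) hZA) (mul_pos (hFB K t τ) hZB) (hlog.trans (hbud K))

/-- **THE ∃δ-EDGE FROM A CLASS-GAS READING** (the shape of the N19′ conjunct `∃ δ, Core … δ ∧ Summable δ`): §2's reading with a summable
budget sequence `δ`. [folklore] -/
theorem coreEdge_of_classGasReading {l₀ vol : ℝ} {T : ℕ → Finset ι} {Bad : ℕ → ℝ → Finset ι} {P' Q' : ℕ → ℝ → ι → ℝ} {δ : ℕ → ℝ}
    (Λ O : ℕ → ℝ → ι → Finset P) (wA wB : ℕ → ℝ → ι → P → ℂ) (a : ℕ → P → ℝ) (FA FB : ℕ → ℝ → ι → ℝ) (c₀ ρ W η : ℕ → ℝ)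
    (hKPA : ∀ K t, |t| ≤ l₀ → ∀ τ ∈ T K \ Bad K t, IsKPVolume inc (wA K t τ) (a K) (Λ K t τ))
    (hKPB : ∀ K t, |t| ≤ l₀ → ∀ τ ∈ T K \ Bad K t, IsKPVolume inc (wB K t τ) (a K) (Λ K t τ))
    (hAr : ∀ K t τ γ, (wA K t τ γ).im = 0) (hBr : ∀ K t τ γ, (wB K t τ γ).im = 0) (hO : ∀ K t τ, O K t τ ⊆ Λ K t τ)
    (hrec : ∀ K t, |t| ≤ l₀ → ∀ τ ∈ T K \ Bad K t,
      ∑ δ' ∈ Λ K t τ \ O K t τ, ‖wA K t τ δ' - wB K t τ δ'‖ * Real.exp (a K δ') ≤ ρ K)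
    (hold : ∀ K t, |t| ≤ l₀ → ∀ τ ∈ T K \ Bad K t, ∑ δ' ∈ O K t τ, (kpTerm (wA K t τ) (a K) δ' + kpTerm (wB K t τ) (a K) δ') ≤ W K)
    (hFA : ∀ K t τ, 0 < FA K t τ) (hFB : ∀ K t τ, 0 < FB K t τ)
    (hF : ∀ K t, |t| ≤ l₀ → ∀ τ ∈ T K \ Bad K t, |Real.log (FB K t τ) - Real.log (FA K t τ) - c₀ K| ≤ η K)
    (hbud : ∀ K, ρ K + W K + η K ≤ vol * δ K) (hδ : Summable δ)
    (hP : ∀ K t, |t| ≤ l₀ → ∀ τ ∈ T K \ Bad K t, P' K t τ = FA K t τ * (polymerPartitionFunction inc (wA K t τ) (Λ K t τ)).re)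
    (hQ : ∀ K t, |t| ≤ l₀ → ∀ τ ∈ T K \ Bad K t, Q' K t τ = FB K t τ * (polymerPartitionFunction inc (wB K t τ) (Λ K t τ)).re) :
    ∃ δ' : ℕ → ℝ, NE7.Core l₀ vol T Bad P' Q' δ' ∧ Summable δ' :=
  ⟨δ, core_of_classGasReading Λ O wA wB a FA FB c₀ ρ W η hKPA hKPB hAr hBr hO hrec hold hFA hFB hF hbud hP hQ, hδ⟩

end AlongK

/-! ## §3 Sanity: the displayed binders are jointly inhabited (content-free) -/

section Sanity

variable [Std.Refl inc] [Std.Symm inc]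

/-- SANITY for §1: equal real KP activities, no old polymers, unit prefactors — the sandwich with constant `0` and radius `0` (both sides
are equalities).  Content-free. [folklore] -/
theorem sandwich_of_classGas_self {w : P → ℂ} {a : P → ℝ} {Λ : Finset P} (hKP : IsKPVolume inc w a Λ) (hr : ∀ γ, (w γ).im = 0) :
    Real.exp (-(0 + 0)) * (polymerPartitionFunction inc w Λ).re ≤ (polymerPartitionFunction inc w Λ).re ∧
      (polymerPartitionFunction inc w Λ).re ≤ Real.exp (0 + 0) * (polymerPartitionFunction inc w Λ).re :=
  sandwich_of_classGas_pure (O := ∅) hKP hKP hr hr (Finset.empty_subset _) (by simp) (by simp)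

end Sanity

end Summit.QuantumFields.YangMills.BalabanUVNodes.N19CoreOfClassGasReading

end
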